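import Literature.Analysis.FluidPDE.SteadyVorticityDecayLiouville
import Literature.Analysis.FluidPDE.WuSteadyLiouville2026
import Literature.Analysis.FluidPDE.VorticityCalculus
import HarnessLib

/-!
# The two tree renderings of Wu (arXiv:2608.22471v1) Corollary 1.2 are equivalent

STATUS FLAG — the underlying statement is a PREPRINT claim (arXiv:2608.22471v1, 23 Aug 2026,
unrefereed); this file adds NO new named fact: it proves, unconditionally, that the two constants
the tree vends for Corollary 1.2 say the same thing, so that the named-fact census may treat them as
one debt and either may be used as the hypothesis of a conditional reduction.

* `Literature.Analysis.FluidPDE.Wu2026_cor12` (module `WuSteadyLiouville2026`, custody file): the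
  printed `limsup_{|x|→∞} |x|^{5/3}|ω(x)| < ∞` rendered as an EVENTUAL bound
  `∃ C R, ∀ y, R ≤ ‖y‖ → ‖y‖^{5/3}‖curl U y‖ ≤ C`;
* `Literature.Analysis.FluidPDE.Wu2026_critical_vorticity_liouville` (module
  `SteadyVorticityDecayLiouville`): the same decay rendered as a GLOBAL Japanese-bracket bound
  `∃ C, ∀ x, ‖curl U x‖ ≤ C(1+‖x‖)^{-5/3}`.

On the common solution class (`IsLerayProfile ν 0 U P`, `U, P ∈ C^∞`, `U → 0` at infinity) the two
vorticity hypotheses are interchangeable: global ⇒ eventual is one line of `rpow` arithmetic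
(`‖y‖^{5/3}·C⟨y⟩^{-5/3} ≤ C`, the sign `C ≥ 0` being forced by the hypothesis itself); eventual ⇒
global uses only that `curl U` is continuous (`continuous_curl`), hence bounded on the closed ball
of radius `max R 1`, together with `1 + ‖x‖ ≤ 2‖x‖` outside it. Hence
`Wu2026_cor12 ↔ Wu2026_critical_vorticity_liouville` (`Wu2026_cor12_iff_critical_vorticity_liouville`).

References: B. Wu, *A Liouville theorem for stationary Navier–Stokes equations under critical
vorticity decay*, arXiv:2608.22471v1 (2026), Cor. 1.2 (p. 2) — preprint, unrefereed.
-/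

noncomputable section

open MeasureTheory Set Function Filter Topology Metric
open scoped ENNReal NNReal

namespace Literature.Analysis.FluidPDE

/-- `a^{5/3} b ≤ K` with `a > 0` gives `b ≤ K a^{-5/3}`. [folklore] -/
private lemma wuBridge_le_mul_rpow_neg_five_thirds {a b K : ℝ} (ha : 0 < a)
    (h : a ^ (5 / 3 : ℝ) * b ≤ K) : b ≤ K * a ^ (-(5 / 3 : ℝ)) := by
  rw [Real.rpow_neg ha.le, ← div_eq_mul_inv, le_div_iff₀ (Real.rpow_pos_of_pos ha _), mul_comm]
  exact h

/-- **Eventual rendering ⇒ global rendering.** Wu's Corollary 1.2 with the printed `limsup`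
hypothesis (`Wu2026_cor12`) implies the version with the global bound
`‖curl U x‖ ≤ C(1+‖x‖)^{-5/3}` (`Wu2026_critical_vorticity_liouville`): a global bound is an
eventual bound with `R = 1`, since `‖y‖^{5/3} · C(1+‖y‖)^{-5/3} ≤ C` (`C ≥ 0` is forced by
`0 ≤ ‖curl U y‖ ≤ C(1+‖y‖)^{-5/3}`). [cite: Wu2026, Cor. 1.2 (p. 2; arXiv:2608.22471v1, preprint, unrefereed)] -/
theorem Wu2026_critical_vorticity_liouville_of_cor12 (h : Wu2026_cor12) :
    Wu2026_critical_vorticity_liouville := by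
  intro ν hν U P hUP hU hP hU0 hcurl
  obtain ⟨C, hC⟩ := hcurl
  refine h ν hν U P hUP hU hP hU0 ⟨C, 1, fun y _ => ?_⟩
  have hb : 0 < 1 + ‖y‖ := by positivity
  have hp : 0 < (1 + ‖y‖) ^ (-(5 / 3 : ℝ)) := Real.rpow_pos_of_pos hb _
  have hC0 : 0 ≤ C := by
    by_contra hlt
    push Not at hlt
    have := mul_neg_of_neg_of_pos hlt hp
    linarith [norm_nonneg (curl U y), hC y]
  have hmono : ‖y‖ ^ (5 / 3 : ℝ) ≤ (1 + ‖y‖) ^ (5 / 3 : ℝ) :=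
    Real.rpow_le_rpow (norm_nonneg _) (by linarith [norm_nonneg y]) (by norm_num)
  have hone : (1 + ‖y‖) ^ (5 / 3 : ℝ) * (1 + ‖y‖) ^ (-(5 / 3 : ℝ)) = 1 := by
    rw [← Real.rpow_add hb]; norm_num
  calc ‖y‖ ^ (5 / 3 : ℝ) * ‖curl U y‖
      ≤ (1 + ‖y‖) ^ (5 / 3 : ℝ) * (C * (1 + ‖y‖) ^ (-(5 / 3 : ℝ))) :=
        mul_le_mul hmono (hC y) (norm_nonneg _) (by positivity)
    _ = C * ((1 + ‖y‖) ^ (5 / 3 : ℝ) * (1 + ‖y‖) ^ (-(5 / 3 : ℝ))) := by ring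
    _ = C := by rw [hone, mul_one]

/-- **Global rendering ⇒ eventual rendering.** Conversely `Wu2026_critical_vorticity_liouville`
implies `Wu2026_cor12`: if `‖y‖^{5/3}‖curl U y‖ ≤ C` for `‖y‖ ≥ R`, then, `curl U` being continuous
(`U ∈ C^∞`) and hence bounded by some `M` on the closed ball of radius `R₁ = max R 1`, the global
bound holds with constant `max (M(1+R₁)^{5/3}) (max C 0 · 2^{5/3})` — inside the ball
`(1+‖x‖)^{5/3}‖curl U x‖ ≤ (1+R₁)^{5/3} M`, outside `(1+‖x‖)^{5/3} ≤ (2‖x‖)^{5/3}`. [cite: Wu2026, Cor. 1.2 (p. 2; arXiv:2608.22471v1, preprint, unrefereed)] -/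
theorem Wu2026_cor12_of_critical_vorticity_liouville (h : Wu2026_critical_vorticity_liouville) :
    Wu2026_cor12 := by
  intro ν hν U P hUP hU hP hU0 hcurl
  obtain ⟨C, R, hCR⟩ := hcurl
  refine h ν hν U P hUP hU hP hU0 ?_
  have hcont : Continuous (curl U) := continuous_curl (hU.of_le (by simp))
  set R₁ : ℝ := max R 1 with hR₁
  have hR₁pos : 1 ≤ R₁ := le_max_right _ _
  obtain ⟨M, hM⟩ : ∃ M, ∀ x ∈ Metric.closedBall (0 : EuclideanSpace ℝ (Fin 3)) R₁,
      ‖curl U x‖ ≤ M :=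
    (isCompact_closedBall _ _).exists_bound_of_continuousOn hcont.continuousOn
  refine ⟨max (M * (1 + R₁) ^ (5 / 3 : ℝ)) (max C 0 * (2 : ℝ) ^ (5 / 3 : ℝ)), fun x => ?_⟩
  have hb : 0 < 1 + ‖x‖ := by positivity
  have hbneg : 0 ≤ (1 + ‖x‖) ^ (-(5 / 3 : ℝ)) := (Real.rpow_pos_of_pos hb _).le
  by_cases hx : ‖x‖ ≤ R₁
  · have h1 : ‖curl U x‖ ≤ M := hM x (by simpa using hx)
    have hM0 : 0 ≤ M := (norm_nonneg _).trans h1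
    have key : (1 + ‖x‖) ^ (5 / 3 : ℝ) * ‖curl U x‖ ≤ M * (1 + R₁) ^ (5 / 3 : ℝ) :=
      calc (1 + ‖x‖) ^ (5 / 3 : ℝ) * ‖curl U x‖
          ≤ (1 + R₁) ^ (5 / 3 : ℝ) * M :=
            mul_le_mul (Real.rpow_le_rpow hb.le (by linarith) (by norm_num)) h1 (norm_nonneg _)
              (by positivity)
        _ = M * (1 + R₁) ^ (5 / 3 : ℝ) := mul_comm _ _
    exact (wuBridge_le_mul_rpow_neg_five_thirds hb key).trans
      (mul_le_mul_of_nonneg_right (le_max_left _ _) hbneg)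
  · push Not at hx
    have hx1 : 1 ≤ ‖x‖ := hR₁pos.trans hx.le
    have hRx : R ≤ ‖x‖ := (le_max_left _ _).trans hx.le
    have h1 : ‖x‖ ^ (5 / 3 : ℝ) * ‖curl U x‖ ≤ max C 0 := (hCR x hRx).trans (le_max_left _ _)
    have h12 : 1 + ‖x‖ ≤ 2 * ‖x‖ := by linarith
    have key : (1 + ‖x‖) ^ (5 / 3 : ℝ) * ‖curl U x‖ ≤ max C 0 * (2 : ℝ) ^ (5 / 3 : ℝ) :=
      calc (1 + ‖x‖) ^ (5 / 3 : ℝ) * ‖curl U x‖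
          ≤ (2 * ‖x‖) ^ (5 / 3 : ℝ) * ‖curl U x‖ :=
            mul_le_mul_of_nonneg_right (Real.rpow_le_rpow hb.le h12 (by norm_num)) (norm_nonneg _)
        _ = (2 : ℝ) ^ (5 / 3 : ℝ) * (‖x‖ ^ (5 / 3 : ℝ) * ‖curl U x‖) := by
            rw [Real.mul_rpow (by norm_num) (norm_nonneg _)]; ring
        _ ≤ (2 : ℝ) ^ (5 / 3 : ℝ) * max C 0 := mul_le_mul_of_nonneg_left h1 (by positivity)
        _ = max C 0 * (2 : ℝ) ^ (5 / 3 : ℝ) := mul_comm _ _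
    exact (wuBridge_le_mul_rpow_neg_five_thirds hb key).trans
      (mul_le_mul_of_nonneg_right (le_max_right _ _) hbneg)

/-- **The two tree renderings of Wu's Corollary 1.2 are equivalent** (this is a statement about
the two `Prop` constants, proved unconditionally; it does not assert either). [cite: Wu2026, Cor. 1.2 (p. 2; arXiv:2608.22471v1, preprint, unrefereed)] -/
theorem Wu2026_cor12_iff_critical_vorticity_liouville :
    Wu2026_cor12 ↔ Wu2026_critical_vorticity_liouville :=
  ⟨Wu2026_critical_vorticity_liouville_of_cor12, Wu2026_cor12_of_critical_vorticity_liouville⟩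

end Literature.Analysis.FluidPDE
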